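import Mathlib
import HarnessLib
import HarnessLib.Audit
import Summits.Langlands.Statement
import Summits.Langlands.Langlands.Theses.SkinnerWilesDefectOne
import Literature.NumberTheory.Automorphic.OrdinaryCompletedCohomologyGL
import Literature.NumberTheory.GaloisRepresentations.HeckeCharacter
import Summits.Langlands.Langlands.Theses.SplitPrimeExitCarving

/-! # BC3 birth skeleton (pre-birth twin: carries verbatim copies of the cell and of the stub statements; `Iff.rfl` to the route decls once born) for
`SplitPrimeExitCarving.RamifiedPrimeExit` (rank 3).  NAMED stubs = the crux-strategist's seam restricted to the cell: the OPEN Hecke-side core X₁∣cell, X₂ (PRINT),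
X₃ (CLOSED-MOD-PRINT) and the two LANDED inputs of the seam (Khare–Thorne 2.10; Hida-tower finiteness from the PROVED Bianchi finiteness item) whose home
modules are outside the farm import cone today; `RamifiedPrimeExit_of` is kernel-checked (sorries ONLY inside `stub_*`). -/

set_option linter.dupNamespace false
set_option linter.unusedVariables false

namespace Summit.Langlands.Langlands.Theses.SplitPrimeExitCarving.Birth.RamifiedPrimeExit

open scoped BigOperators Topology Manifold Classical MeasureTheory ProbabilityTheory Matrix InnerProductSpace ComplexConjugate ContinuousMap
open Filter Set Function TopologicalSpace MeasureTheory

/-- verbatim copy of the cell `RamifiedPrimeExit` (texts.json; = the route decl by `Iff.rfl` after birth). -/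
def RamifiedPrimeExit : Prop :=
  ∀ (F : Type) [Field F] [NumberField F], NumberField.IsTotallyComplex F → Module.finrank ℚ F = 2 → ∀ (p : ℕ) [Fact p.Prime], p ≠ 2 → ¬ (∃ v w : IsDedekindDomain.HeightOneSpectrum (NumberField.RingOfIntegers F), v ≠ w ∧ (p : NumberField.RingOfIntegers F) ∈ v.asIdeal ∧ (p : NumberField.RingOfIntegers F) ∈ w.asIdeal) → (∃ v : IsDedekindDomain.HeightOneSpectrum (NumberField.RingOfIntegers F), (p : NumberField.RingOfIntegers F) ∈ v.asIdeal ^ 2) → ∀ (hcpt : Literature.NumberTheory.Automorphic.isCompact_glFiniteIntegralLevel 2 F) (ι : PadicAlgCl p ≃+* ℂ) (ρ : Literature.NumberTheory.GaloisRepresentations.FramedGaloisRep F (PadicAlgCl p) 2), ρ.toGaloisRep.IsIrreducible → (∀ᶠ v in cofinite, ρ.IsUnramifiedAt v) → (∃ 𝒰 : Literature.NumberTheory.Automorphic.BigHeckeGLn.TameLevel 2 F p, 𝒰.IsPadicallyAutomorphic ρ) → (∃ k : ℕ, 2 ≤ k ∧ ∃ m : ℕ, 0 < m ∧ ∀ v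 : IsDedekindDomain.HeightOneSpectrum (NumberField.RingOfIntegers F), (p : NumberField.RingOfIntegers F) ∈ v.asIdeal → ρ.IsOrdinaryOfWeightAt p v k m) → ∃ π : Literature.NumberTheory.Automorphic.CuspidalAutomorphicRepData 2 F hcpt, π.1.IsLAlgebraic ∧ ∀ᶠ v in cofinite, Summit.Langlands.SatakeFrobCompatibleAt ι π.1 ρ v

/-- X₁∣RAMIFIED — OPEN (p ∣ d_F; F_v/ℚ_p ramified quadratic, k_v = 𝔽_p): no p-adic LLC engine AND outside both typed local barriers as typed — catalogue gap; UNDECIDED/IDEA-NEEDED. Same Hecke-side normal form with the dial ¬SPLIT → RAM inserted. -/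
theorem stub_ramifiedOrdinaryFactorisationNonCM :
    ∀ (F : Type) [Field F] [NumberField F], NumberField.IsTotallyComplex F → Module.finrank ℚ F = 2 → ∀ (p : ℕ) [Fact p.Prime], p ≠ 2 → ¬ (∃ v w : IsDedekindDomain.HeightOneSpectrum (NumberField.RingOfIntegers F), v ≠ w ∧ (p : NumberField.RingOfIntegers F) ∈ v.asIdeal ∧ (p : NumberField.RingOfIntegers F) ∈ w.asIdeal) → (∃ v : IsDedekindDomain.HeightOneSpectrum (NumberField.RingOfIntegers F), (p : NumberField.RingOfIntegers F) ∈ v.asIdeal ^ 2) → ∀ (ι : PadicAlgCl p ≃+* ℂ) (ρ : Literature.NumberTheory.GaloisRepresentations.FramedGaloisRep F (PadicAlgCl p) 2) (k m : ℕ), ρ.toGaloisRep.IsIrreducible → (¬ ∃ (K : Type) (_ : Field K) (_ : NumberField K) (_ : Algebra F K) (_ : Module.finrank F K = 2) (θ : Literature.NumberTheory.GaloisRepresentations.HeckeCharacter K), θ.IsAlgebraic ∧ (∃ᶠ w : IsDedekindDomain.HeightOneSpectrum (NumberField.RingOfIntegers K) in Filter.cofinite, ∃ w' : IsDedekindDomain.HeightOneSpectrum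 (NumberField.RingOfIntegers K), w'.asIdeal.under (NumberField.RingOfIntegers F) = w.asIdeal.under (NumberField.RingOfIntegers F) ∧ θ.valueAtUniformizer w' ≠ θ.valueAtUniformizer w) ∧ ∀ᶠ v : IsDedekindDomain.HeightOneSpectrum (NumberField.RingOfIntegers F) in Filter.cofinite, ρ.IsUnramifiedAt v ∧ ρ.HasFrobCharpolyAt v (∏ᶠ w ∈ {w : IsDedekindDomain.HeightOneSpectrum (NumberField.RingOfIntegers K) | w.under (NumberField.RingOfIntegers F) = v}, (Polynomial.X ^ w.asIdeal.inertiaDeg (NumberField.RingOfIntegers F) - Polynomial.C (ι.symm (θ.valueAtUniformizer w)⁻¹)))) → (∀ᶠ v in Filter.cofinite, ρ.IsUnramifiedAt v) → (∃ 𝒰 : Literature.NumberTheory.Automorphic.BigHeckeGLn.TameLevel 2 F p, 𝒰.IsPadicallyAutomorphic ρ) → 2 ≤ k → 0 < m → (∀ v : IsDedekindDomain.HeightOneSpectrum (NumberField.RingOfIntegers F), (p : NumberField.RingOfIntegers F) ∈ v.asIdeal → ρ.IsOrdinaryOfWeightAt p v k m) → ∃ 𝒰 : Literature.NumberTheory.Automorphic.BigHeckeGLn.TameLevel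 2 F p, 𝒰.IsMaximalAbove ∧ ∃ y : Literature.NumberTheory.Automorphic.HidaHeckeAlgebraGLn 𝒰 →+* PadicAlgCl p, Continuous y ∧ 𝒰.IsHidaAssociated y ρ ∧ (∀ v : IsDedekindDomain.HeightOneSpectrum (NumberField.RingOfIntegers F), (p : NumberField.RingOfIntegers F) ∈ v.asIdeal → 𝒰.IsSlopeZeroAt y v) ∧ ∃ N : ℕ, 0 < N ∧ ∀ (u : NumberField.RingOfIntegers F) (û : ∀ v : IsDedekindDomain.HeightOneSpectrum (NumberField.RingOfIntegers F), (p : NumberField.RingOfIntegers F) ∈ v.asIdeal → (v.adicCompletionIntegers F)ˣ), (∀ (v : IsDedekindDomain.HeightOneSpectrum (NumberField.RingOfIntegers F)) (hv : (p : NumberField.RingOfIntegers F) ∈ v.asIdeal), ((û v hv : v.adicCompletionIntegers F) : v.adicCompletion F) = algebraMap F (v.adicCompletion F) (u : F)) → (∏ᶠ v : {v : IsDedekindDomain.HeightOneSpectrum (NumberField.RingOfIntegers F) // (p : NumberField.RingOfIntegers F) ∈ v.asIdeal}, y (𝒰.hidaDiamond v.2 (Pi.mulSingle (0 : Fin 2)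 (û v.1 v.2)))) ^ N = 1 := by
  sorry

/-- X₂ — PRINT (cuspidal cyclic automorphic induction AC89 Ch. 3 Thm 6.2 / L. 6.4 + Henniart 2012 Thm 3 (i); LANDED modulo those two named facts: `cmInducedCuspidal_of_two_facts` p112953 ∘ `stub_cmSatakeFrobGlue` p106683 — certificate in anchors.lean): CM-induced ρ ↔ L-algebraic cuspidal π a.e. -/
theorem stub_cmInducedClassical :
    ∀ (F : Type) [Field F] [NumberField F] (p : ℕ) [Fact p.Prime] (hcpt : Literature.NumberTheory.Automorphic.isCompact_glFiniteIntegralLevel 2 F) (ι : PadicAlgCl p ≃+* ℂ) (ρ : Literature.NumberTheory.GaloisRepresentations.FramedGaloisRep F (PadicAlgCl p) 2), (∃ (K : Type) (_ : Field K) (_ : NumberField K) (_ : Algebra F K) (_ : Module.finrank F K = 2) (θ : Literature.NumberTheory.GaloisRepresentations.HeckeCharacter K), θ.IsAlgebraic ∧ (∃ᶠ w : IsDedekindDomain.HeightOneSpectrum (NumberField.RingOfIntegers K) in Filter.cofinite, ∃ w' : IsDedekindDomain.HeightOneSpectrum (NumberField.RingOfIntegers K), w'.asIdeal.under (NumberField.RingOfIntegers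 F) = w.asIdeal.under (NumberField.RingOfIntegers F) ∧ θ.valueAtUniformizer w' ≠ θ.valueAtUniformizer w) ∧ ∀ᶠ v : IsDedekindDomain.HeightOneSpectrum (NumberField.RingOfIntegers F) in Filter.cofinite, ρ.IsUnramifiedAt v ∧ ρ.HasFrobCharpolyAt v (∏ᶠ w ∈ {w : IsDedekindDomain.HeightOneSpectrum (NumberField.RingOfIntegers K) | w.under (NumberField.RingOfIntegers F) = v}, (Polynomial.X ^ w.asIdeal.inertiaDeg (NumberField.RingOfIntegers F) - Polynomial.C (ι.symm (θ.valueAtUniformizer w)⁻¹)))) → ∃ π : Literature.NumberTheory.Automorphic.CuspidalAutomorphicRepData 2 F hcpt, π.1.IsLAlgebraic ∧ ∀ᶠ v in Filter.cofinite, Summit.Langlands.SatakeFrobCompatibleAt ι π.1 ρ v := by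
  sorry

/-- X₃ — CLOSED-MOD-PRINT (landed `ordinarilyProModularOrdinaryClassical` p96987 modulo Hida control for dominant ordinary points `hidaControl_dominantOrdinaryPoint` [Hida1994AIF Thm 3.2] and Eichler–Shimura–Harder `bianchi_interiorEigenclass_isCuspidal` [Harder1987 §3]; boundary reducibility is the tree THEOREM `bianchi_boundaryEigensystem_isReducible_holds` — certificate in anchors.lean): ordinarily pro-modular Galois-ordinary ρ of weight k ≥ 2 is classical. -/
theorem stub_ordinarilyProModularOrdinaryClassical :
    ∀ (F : Type) [Field F] [NumberField F], NumberField.IsTotallyComplex F → Module.finrank ℚ F = 2 → ∀ (p : ℕ) [Fact p.Prime], p ≠ 2 → ∀ (hcpt : Literature.NumberTheory.Automorphic.isCompact_glFiniteIntegralLevel 2 F) (ι : PadicAlgCl p ≃+* ℂ) (ρ : Literature.NumberTheory.GaloisRepresentations.FramedGaloisRep F (PadicAlgCl p) 2), ρ.toGaloisRep.IsIrreducible → (∃ 𝒰 : Literature.NumberTheory.Automorphic.BigHeckeGLn.TameLevel 2 F p, 𝒰.IsMaximalAbove ∧ ∃ x : Literature.NumberTheory.Automorphic.OrdinaryHeckeAlgebraGLn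 𝒰 →+* PadicAlgCl p, Continuous x ∧ 𝒰.IsOrdAssociated x ρ ∧ ∃ N : ℕ, 0 < N ∧ ∀ (u : NumberField.RingOfIntegers F) (û : ∀ v : IsDedekindDomain.HeightOneSpectrum (NumberField.RingOfIntegers F), (p : NumberField.RingOfIntegers F) ∈ v.asIdeal → (v.adicCompletionIntegers F)ˣ), (∀ (v : IsDedekindDomain.HeightOneSpectrum (NumberField.RingOfIntegers F)) (hv : (p : NumberField.RingOfIntegers F) ∈ v.asIdeal), ((û v hv : v.adicCompletionIntegers F) : v.adicCompletion F) = algebraMap F (v.adicCompletion F) (u : F)) → (∏ᶠ v : {v : IsDedekindDomain.HeightOneSpectrum (NumberField.RingOfIntegers F) // (p : NumberField.RingOfIntegers F) ∈ v.asIdeal}, x (𝒰.ordDiamond v.2 (Pi.mulSingle (0 : Fin 2) (û v.1 v.2)))) ^ N = 1) → (∃ k : ℕ, 2 ≤ k ∧ ∃ m : ℕ, 0 < m ∧ ∀ v : IsDedekindDomain.HeightOneSpectrum (NumberField.RingOfIntegers F), (p : NumberField.RingOfIntegers F) ∈ v.asIdeal → ρ.IsOrdinaryOfWeightAt p v k m)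 → ∃ π : Literature.NumberTheory.Automorphic.CuspidalAutomorphicRepData 2 F hcpt, π.1.IsLAlgebraic ∧ ∀ᶠ v in Filter.cofinite, Summit.Langlands.SatakeFrobCompatibleAt ι π.1 ρ v := by
  sorry

/-- LANDED — Khare–Thorne Lemma 2.10 for the tree's Hida tower = `stub_slopeZeroFactorisation` (p98105) VERBATIM; discharge `exact stub_slopeZeroFactorisation` (module outside this file's farm import cone today; anchors.lean). -/
theorem stub_slopeZeroFactorisationKT :
    ∀ (F : Type) [Field F] [NumberField F] (p : ℕ) [Fact p.Prime] (𝒰 : Literature.NumberTheory.Automorphic.BigHeckeGLn.TameLevel 2 F p), 𝒰.IsMaximalAbove → (∀ ι : Literature.NumberTheory.Automorphic.TowerIndex, Finite (𝒰.hidaCohomology ℤ ι)) → ∀ (y : Literature.NumberTheory.Automorphic.HidaHeckeAlgebraGLn 𝒰 →+* PadicAlgCl p), Continuous y → (∀ v : IsDedekindDomain.HeightOneSpectrum (NumberField.RingOfIntegers F), (p : NumberField.RingOfIntegers F) ∈ v.asIdeal → 𝒰.IsSlopeZeroAt y v) → ∃ x : Literature.NumberTheory.Automorphic.OrdinaryHeckeAlgebraGLn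 𝒰 →+* PadicAlgCl p, Continuous x ∧ x.comp (𝒰.toOrd ℤ) = y := by
  sorry

/-- LANDED — `hidaCohomology_finite_of_bianchi` (p112149) ∘ the PROVED route item `BianchiCongruenceCohomologyFinite` (stmt-Langlands-15362, `BianchiCongruenceCohomologyFinite_proof`); discharge in anchors.lean (modules outside the farm cone today). -/
theorem stub_hidaTowerCohomologyFiniteQuadratic :
    ∀ (K : Type) [Field K] [NumberField K], Module.finrank ℚ K = 2 → NumberField.IsTotallyComplex K → ∀ (p : ℕ) [Fact p.Prime] (𝒰 : Literature.NumberTheory.Automorphic.BigHeckeGLn.TameLevel 2 K p) (x : Literature.NumberTheory.Automorphic.TowerIndex), Finite (𝒰.hidaCohomology ℤ x) := by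
  sorry

section Seam

open Summit.Langlands.Langlands.Theses.SkinnerWilesDefectOne
open Literature.NumberTheory.Automorphic Literature.NumberTheory.GaloisRepresentations
open Literature.NumberTheory.Automorphic.BigHeckeGLn
open NumberField IsDedekindDomain Filter Polynomial

/-- node copies of the two anchored inputs (by name, for the seam). -/
def SlopeZeroFactorisationKT : Prop :=
  ∀ (F : Type) [Field F] [NumberField F] (p : ℕ) [Fact p.Prime] (𝒰 : Literature.NumberTheory.Automorphic.BigHeckeGLn.TameLevel 2 F p), 𝒰.IsMaximalAbove → (∀ ι : Literature.NumberTheory.Automorphic.TowerIndex, Finite (𝒰.hidaCohomology ℤ ι)) → ∀ (y : Literature.NumberTheory.Automorphic.HidaHeckeAlgebraGLn 𝒰 →+* PadicAlgCl p), Continuous y → (∀ v : IsDedekindDomain.HeightOneSpectrum (NumberField.RingOfIntegers F), (p : NumberField.RingOfIntegers F) ∈ v.asIdeal → 𝒰.IsSlopeZeroAt y v) → ∃ x : Literature.NumberTheory.Automorphic.OrdinaryHeckeAlgebraGLn 𝒰 →+* PadicAlgCl p, Continuous x ∧ x.comp (𝒰.toOrd ℤ) = y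

def HidaTowerCohomologyFiniteQuadratic : Prop :=
  ∀ (K : Type) [Field K] [NumberField K], Module.finrank ℚ K = 2 → NumberField.IsTotallyComplex K → ∀ (p : ℕ) [Fact p.Prime] (𝒰 : Literature.NumberTheory.Automorphic.BigHeckeGLn.TameLevel 2 K p) (x : Literature.NumberTheory.Automorphic.TowerIndex), Finite (𝒰.hidaCohomology ℤ x)

theorem seam_at (hKT : SlopeZeroFactorisationKT) (hfin : HidaTowerCohomologyFiniteQuadratic)
    (F : Type) [Field F] [NumberField F] (hF : NumberField.IsTotallyComplex F) (hdeg : Module.finrank ℚ F = 2)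
    (p : ℕ) [Fact p.Prime] (hp : p ≠ 2)
    (hOF : ∀ (ι : PadicAlgCl p ≃+* ℂ) (ρ : Literature.NumberTheory.GaloisRepresentations.FramedGaloisRep F (PadicAlgCl p) 2) (k m : ℕ), ρ.toGaloisRep.IsIrreducible → (¬ ∃ (K : Type) (_ : Field K) (_ : NumberField K) (_ : Algebra F K) (_ : Module.finrank F K = 2) (θ : Literature.NumberTheory.GaloisRepresentations.HeckeCharacter K), θ.IsAlgebraic ∧ (∃ᶠ w : IsDedekindDomain.HeightOneSpectrum (NumberField.RingOfIntegers K) in Filter.cofinite, ∃ w' : IsDedekindDomain.HeightOneSpectrum (NumberField.RingOfIntegers K), w'.asIdeal.under (NumberField.RingOfIntegers F) = w.asIdeal.under (NumberField.RingOfIntegers F) ∧ θ.valueAtUniformizer w' ≠ θ.valueAtUniformizer w) ∧ ∀ᶠ v : IsDedekindDomain.HeightOneSpectrum (NumberField.RingOfIntegers F) in Filter.cofinite, ρ.IsUnramifiedAt v ∧ ρ.HasFrobCharpolyAt v (∏ᶠ w ∈ {w : IsDedekindDomain.HeightOneSpectrum (NumberField.RingOfIntegers K) | w.under (NumberField.RingOfIntegers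 F) = v}, (Polynomial.X ^ w.asIdeal.inertiaDeg (NumberField.RingOfIntegers F) - Polynomial.C (ι.symm (θ.valueAtUniformizer w)⁻¹)))) → (∀ᶠ v in Filter.cofinite, ρ.IsUnramifiedAt v) → (∃ 𝒰 : Literature.NumberTheory.Automorphic.BigHeckeGLn.TameLevel 2 F p, 𝒰.IsPadicallyAutomorphic ρ) → 2 ≤ k → 0 < m → (∀ v : IsDedekindDomain.HeightOneSpectrum (NumberField.RingOfIntegers F), (p : NumberField.RingOfIntegers F) ∈ v.asIdeal → ρ.IsOrdinaryOfWeightAt p v k m) → ∃ 𝒰 : Literature.NumberTheory.Automorphic.BigHeckeGLn.TameLevel 2 F p, 𝒰.IsMaximalAbove ∧ ∃ y : Literature.NumberTheory.Automorphic.HidaHeckeAlgebraGLn 𝒰 →+* PadicAlgCl p, Continuous y ∧ 𝒰.IsHidaAssociated y ρ ∧ (∀ v : IsDedekindDomain.HeightOneSpectrum (NumberField.RingOfIntegers F), (p : NumberField.RingOfIntegers F) ∈ v.asIdeal → 𝒰.IsSlopeZeroAt y v) ∧ ∃ N : ℕ, 0 < N ∧ ∀ (u : NumberField.RingOfIntegers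 F) (û : ∀ v : IsDedekindDomain.HeightOneSpectrum (NumberField.RingOfIntegers F), (p : NumberField.RingOfIntegers F) ∈ v.asIdeal → (v.adicCompletionIntegers F)ˣ), (∀ (v : IsDedekindDomain.HeightOneSpectrum (NumberField.RingOfIntegers F)) (hv : (p : NumberField.RingOfIntegers F) ∈ v.asIdeal), ((û v hv : v.adicCompletionIntegers F) : v.adicCompletion F) = algebraMap F (v.adicCompletion F) (u : F)) → (∏ᶠ v : {v : IsDedekindDomain.HeightOneSpectrum (NumberField.RingOfIntegers F) // (p : NumberField.RingOfIntegers F) ∈ v.asIdeal}, y (𝒰.hidaDiamond v.2 (Pi.mulSingle (0 : Fin 2) (û v.1 v.2)))) ^ N = 1)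
    (hCM : ∀ (hcpt : Literature.NumberTheory.Automorphic.isCompact_glFiniteIntegralLevel 2 F) (ι : PadicAlgCl p ≃+* ℂ) (ρ : Literature.NumberTheory.GaloisRepresentations.FramedGaloisRep F (PadicAlgCl p) 2), (∃ (K : Type) (_ : Field K) (_ : NumberField K) (_ : Algebra F K) (_ : Module.finrank F K = 2) (θ : Literature.NumberTheory.GaloisRepresentations.HeckeCharacter K), θ.IsAlgebraic ∧ (∃ᶠ w : IsDedekindDomain.HeightOneSpectrum (NumberField.RingOfIntegers K) in Filter.cofinite, ∃ w' : IsDedekindDomain.HeightOneSpectrum (NumberField.RingOfIntegers K), w'.asIdeal.under (NumberField.RingOfIntegers F) = w.asIdeal.under (NumberField.RingOfIntegers F) ∧ θ.valueAtUniformizer w' ≠ θ.valueAtUniformizer w) ∧ ∀ᶠ v : IsDedekindDomain.HeightOneSpectrum (NumberField.RingOfIntegers F) in Filter.cofinite, ρ.IsUnramifiedAt v ∧ ρ.HasFrobCharpolyAt v (∏ᶠ w ∈ {w : IsDedekindDomain.HeightOneSpectrum (NumberField.RingOfIntegers K) | w.under (NumberField.RingOfIntegers F) = v}, (Polynomial.X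 ^ w.asIdeal.inertiaDeg (NumberField.RingOfIntegers F) - Polynomial.C (ι.symm (θ.valueAtUniformizer w)⁻¹)))) → ∃ π : Literature.NumberTheory.Automorphic.CuspidalAutomorphicRepData 2 F hcpt, π.1.IsLAlgebraic ∧ ∀ᶠ v in Filter.cofinite, Summit.Langlands.SatakeFrobCompatibleAt ι π.1 ρ v)
    (hOrd : ∀ (hcpt : Literature.NumberTheory.Automorphic.isCompact_glFiniteIntegralLevel 2 F) (ι : PadicAlgCl p ≃+* ℂ) (ρ : Literature.NumberTheory.GaloisRepresentations.FramedGaloisRep F (PadicAlgCl p) 2), ρ.toGaloisRep.IsIrreducible → (∃ 𝒰 : Literature.NumberTheory.Automorphic.BigHeckeGLn.TameLevel 2 F p, 𝒰.IsMaximalAbove ∧ ∃ x : Literature.NumberTheory.Automorphic.OrdinaryHeckeAlgebraGLn 𝒰 →+* PadicAlgCl p, Continuous x ∧ 𝒰.IsOrdAssociated x ρ ∧ ∃ N : ℕ, 0 < N ∧ ∀ (u : NumberField.RingOfIntegers F) (û : ∀ v : IsDedekindDomain.HeightOneSpectrum (NumberField.RingOfIntegers F), (p : NumberField.RingOfIntegers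 F) ∈ v.asIdeal → (v.adicCompletionIntegers F)ˣ), (∀ (v : IsDedekindDomain.HeightOneSpectrum (NumberField.RingOfIntegers F)) (hv : (p : NumberField.RingOfIntegers F) ∈ v.asIdeal), ((û v hv : v.adicCompletionIntegers F) : v.adicCompletion F) = algebraMap F (v.adicCompletion F) (u : F)) → (∏ᶠ v : {v : IsDedekindDomain.HeightOneSpectrum (NumberField.RingOfIntegers F) // (p : NumberField.RingOfIntegers F) ∈ v.asIdeal}, x (𝒰.ordDiamond v.2 (Pi.mulSingle (0 : Fin 2) (û v.1 v.2)))) ^ N = 1) → (∃ k : ℕ, 2 ≤ k ∧ ∃ m : ℕ, 0 < m ∧ ∀ v : IsDedekindDomain.HeightOneSpectrum (NumberField.RingOfIntegers F), (p : NumberField.RingOfIntegers F) ∈ v.asIdeal → ρ.IsOrdinaryOfWeightAt p v k m) → ∃ π : Literature.NumberTheory.Automorphic.CuspidalAutomorphicRepData 2 F hcpt, π.1.IsLAlgebraic ∧ ∀ᶠ v in Filter.cofinite, Summit.Langlands.SatakeFrobCompatibleAt ι π.1 ρ v) :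
    ∀ (hcpt : Literature.NumberTheory.Automorphic.isCompact_glFiniteIntegralLevel 2 F) (ι : PadicAlgCl p ≃+* ℂ) (ρ : Literature.NumberTheory.GaloisRepresentations.FramedGaloisRep F (PadicAlgCl p) 2), ρ.toGaloisRep.IsIrreducible → (∀ᶠ v in cofinite, ρ.IsUnramifiedAt v) → (∃ 𝒰 : Literature.NumberTheory.Automorphic.BigHeckeGLn.TameLevel 2 F p, 𝒰.IsPadicallyAutomorphic ρ) → (∃ k : ℕ, 2 ≤ k ∧ ∃ m : ℕ, 0 < m ∧ ∀ v : IsDedekindDomain.HeightOneSpectrum (NumberField.RingOfIntegers F), (p : NumberField.RingOfIntegers F) ∈ v.asIdeal → ρ.IsOrdinaryOfWeightAt p v k m) → ∃ π : Literature.NumberTheory.Automorphic.CuspidalAutomorphicRepData 2 F hcpt, π.1.IsLAlgebraic ∧ ∀ᶠ v in cofinite, Summit.Langlands.SatakeFrobCompatibleAt ι π.1 ρ v := by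
  intro hcpt ι ρ hirr hunr hpm hord
  by_cases hcm : ∃ (K : Type) (_ : Field K) (_ : NumberField K) (_ : Algebra F K) (_ : Module.finrank F K = 2) (θ : Literature.NumberTheory.GaloisRepresentations.HeckeCharacter K), θ.IsAlgebraic ∧ (∃ᶠ w : IsDedekindDomain.HeightOneSpectrum (NumberField.RingOfIntegers K) in Filter.cofinite, ∃ w' : IsDedekindDomain.HeightOneSpectrum (NumberField.RingOfIntegers K), w'.asIdeal.under (NumberField.RingOfIntegers F) = w.asIdeal.under (NumberField.RingOfIntegers F) ∧ θ.valueAtUniformizer w' ≠ θ.valueAtUniformizer w) ∧ ∀ᶠ v : IsDedekindDomain.HeightOneSpectrum (NumberField.RingOfIntegers F) in Filter.cofinite, ρ.IsUnramifiedAt v ∧ ρ.HasFrobCharpolyAt v (∏ᶠ w ∈ {w : IsDedekindDomain.HeightOneSpectrum (NumberField.RingOfIntegers K) | w.under (NumberField.RingOfIntegers F) = v}, (Polynomial.X ^ w.asIdeal.inertiaDeg (NumberField.RingOfIntegers F) - Polynomial.C (ι.symm (θ.valueAtUniformizer w)⁻¹)))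
  · -- the CM regime: X₂, no pro-modularity / ordinarity used
    exact hCM hcpt ι ρ hcm
  · -- the non-CM regime: X₁ ⇒ slope-zero Iwahori point; KT 2.10 with Bianchi finiteness; transport; X₃
    obtain ⟨k, hk, m, hm, hv⟩ := hord
    obtain ⟨𝒰, h𝒰, y, hy, hass, hslope, N, hN, hslot⟩ := hOF ι ρ k m hirr hcm hunr hpm hk hm hv
    have hfin' : ∀ x : TowerIndex, Finite (𝒰.hidaCohomology ℤ x) := fun x => hfin F hdeg hF p 𝒰 x
    obtain ⟨x, hx, hxy⟩ := hKT F p 𝒰 h𝒰 hfin' y hy hslope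
    have hassx : 𝒰.IsOrdAssociated x ρ := by
      have hfun : (fun w j => x (𝒰.ordT w j)) = fun w j => y (𝒰.hidaT w j) := by
        funext w j
        rw [← hxy, RingHom.comp_apply, TameLevel.toOrd_hidaT]
      show IsAssociatedFamily 2 𝒰.bad (fun w j => x (𝒰.ordT w j)) ρ
      rw [hfun]
      exact hass
    have hslotx : ∃ N : ℕ, 0 < N ∧ ∀ (u : 𝓞 F)
        (û : ∀ v : HeightOneSpectrum (𝓞 F), (p : 𝓞 F) ∈ v.asIdeal → (v.adicCompletionIntegers F)ˣ),
        (∀ (v : HeightOneSpectrum (𝓞 F)) (hv : (p : 𝓞 F) ∈ v.asIdeal),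
          ((û v hv : v.adicCompletionIntegers F) : v.adicCompletion F) = algebraMap F (v.adicCompletion F) (u : F)) →
        (∏ᶠ v : {v : HeightOneSpectrum (𝓞 F) // (p : 𝓞 F) ∈ v.asIdeal},
          x (𝒰.ordDiamond v.2 (Pi.mulSingle (0 : Fin 2) (û v.1 v.2)))) ^ N = 1 := by
      refine ⟨N, hN, fun u û hû => ?_⟩
      have hdia : ∀ v : {v : HeightOneSpectrum (𝓞 F) // (p : 𝓞 F) ∈ v.asIdeal},
          x (𝒰.ordDiamond v.2 (Pi.mulSingle (0 : Fin 2) (û v.1 v.2))) =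
            y (𝒰.hidaDiamond v.2 (Pi.mulSingle (0 : Fin 2) (û v.1 v.2))) := by
        intro v
        rw [← hxy, RingHom.comp_apply, TameLevel.toOrd_hidaDiamond]
      simp only [hdia]
      exact hslot u û hû
    exact hOrd hcpt ι ρ hirr ⟨𝒰, h𝒰, x, hx, hassx, hslotx⟩ ⟨k, hk, m, hm, hv⟩

end Seam

/-- `RamifiedPrimeExit` from its five stubs (kernel-checked, no sorry): fix `(F, p)` and the dial hypothesis, then the seam. -/
theorem RamifiedPrimeExit_of
    (h1 : ∀ (F : Type) [Field F] [NumberField F], NumberField.IsTotallyComplex F → Module.finrank ℚ F = 2 → ∀ (p : ℕ) [Fact p.Prime], p ≠ 2 → ¬ (∃ v w : IsDedekindDomain.HeightOneSpectrum (NumberField.RingOfIntegers F), v ≠ w ∧ (p : NumberField.RingOfIntegers F) ∈ v.asIdeal ∧ (p : NumberField.RingOfIntegers F) ∈ w.asIdeal) → (∃ v : IsDedekindDomain.HeightOneSpectrum (NumberField.RingOfIntegers F), (p : NumberField.RingOfIntegers F) ∈ v.asIdeal ^ 2) → ∀ (ι : PadicAlgCl p ≃+* ℂ) (ρ : Literature.NumberTheory.GaloisRepresentations.FramedGaloisRep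 F (PadicAlgCl p) 2) (k m : ℕ), ρ.toGaloisRep.IsIrreducible → (¬ ∃ (K : Type) (_ : Field K) (_ : NumberField K) (_ : Algebra F K) (_ : Module.finrank F K = 2) (θ : Literature.NumberTheory.GaloisRepresentations.HeckeCharacter K), θ.IsAlgebraic ∧ (∃ᶠ w : IsDedekindDomain.HeightOneSpectrum (NumberField.RingOfIntegers K) in Filter.cofinite, ∃ w' : IsDedekindDomain.HeightOneSpectrum (NumberField.RingOfIntegers K), w'.asIdeal.under (NumberField.RingOfIntegers F) = w.asIdeal.under (NumberField.RingOfIntegers F) ∧ θ.valueAtUniformizer w' ≠ θ.valueAtUniformizer w) ∧ ∀ᶠ v : IsDedekindDomain.HeightOneSpectrum (NumberField.RingOfIntegers F) in Filter.cofinite, ρ.IsUnramifiedAt v ∧ ρ.HasFrobCharpolyAt v (∏ᶠ w ∈ {w : IsDedekindDomain.HeightOneSpectrum (NumberField.RingOfIntegers K) | w.under (NumberField.RingOfIntegers F) = v}, (Polynomial.X ^ w.asIdeal.inertiaDeg (NumberField.RingOfIntegers F) - Polynomial.C (ι.symm (θ.valueAtUniformizer w)⁻¹)))) → (∀ᶠ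 v in Filter.cofinite, ρ.IsUnramifiedAt v) → (∃ 𝒰 : Literature.NumberTheory.Automorphic.BigHeckeGLn.TameLevel 2 F p, 𝒰.IsPadicallyAutomorphic ρ) → 2 ≤ k → 0 < m → (∀ v : IsDedekindDomain.HeightOneSpectrum (NumberField.RingOfIntegers F), (p : NumberField.RingOfIntegers F) ∈ v.asIdeal → ρ.IsOrdinaryOfWeightAt p v k m) → ∃ 𝒰 : Literature.NumberTheory.Automorphic.BigHeckeGLn.TameLevel 2 F p, 𝒰.IsMaximalAbove ∧ ∃ y : Literature.NumberTheory.Automorphic.HidaHeckeAlgebraGLn 𝒰 →+* PadicAlgCl p, Continuous y ∧ 𝒰.IsHidaAssociated y ρ ∧ (∀ v : IsDedekindDomain.HeightOneSpectrum (NumberField.RingOfIntegers F), (p : NumberField.RingOfIntegers F) ∈ v.asIdeal → 𝒰.IsSlopeZeroAt y v) ∧ ∃ N : ℕ, 0 < N ∧ ∀ (u : NumberField.RingOfIntegers F) (û : ∀ v : IsDedekindDomain.HeightOneSpectrum (NumberField.RingOfIntegers F), (p : NumberField.RingOfIntegers F) ∈ v.asIdeal → (v.adicCompletionIntegers F)ˣ),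 (∀ (v : IsDedekindDomain.HeightOneSpectrum (NumberField.RingOfIntegers F)) (hv : (p : NumberField.RingOfIntegers F) ∈ v.asIdeal), ((û v hv : v.adicCompletionIntegers F) : v.adicCompletion F) = algebraMap F (v.adicCompletion F) (u : F)) → (∏ᶠ v : {v : IsDedekindDomain.HeightOneSpectrum (NumberField.RingOfIntegers F) // (p : NumberField.RingOfIntegers F) ∈ v.asIdeal}, y (𝒰.hidaDiamond v.2 (Pi.mulSingle (0 : Fin 2) (û v.1 v.2)))) ^ N = 1)
    (h2 : ∀ (F : Type) [Field F] [NumberField F] (p : ℕ) [Fact p.Prime] (hcpt : Literature.NumberTheory.Automorphic.isCompact_glFiniteIntegralLevel 2 F) (ι : PadicAlgCl p ≃+* ℂ) (ρ : Literature.NumberTheory.GaloisRepresentations.FramedGaloisRep F (PadicAlgCl p) 2), (∃ (K : Type) (_ : Field K) (_ : NumberField K) (_ : Algebra F K) (_ : Module.finrank F K = 2) (θ : Literature.NumberTheory.GaloisRepresentations.HeckeCharacter K), θ.IsAlgebraic ∧ (∃ᶠ w : IsDedekindDomain.HeightOneSpectrum (NumberField.RingOfIntegers K) in Filter.cofinite,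 ∃ w' : IsDedekindDomain.HeightOneSpectrum (NumberField.RingOfIntegers K), w'.asIdeal.under (NumberField.RingOfIntegers F) = w.asIdeal.under (NumberField.RingOfIntegers F) ∧ θ.valueAtUniformizer w' ≠ θ.valueAtUniformizer w) ∧ ∀ᶠ v : IsDedekindDomain.HeightOneSpectrum (NumberField.RingOfIntegers F) in Filter.cofinite, ρ.IsUnramifiedAt v ∧ ρ.HasFrobCharpolyAt v (∏ᶠ w ∈ {w : IsDedekindDomain.HeightOneSpectrum (NumberField.RingOfIntegers K) | w.under (NumberField.RingOfIntegers F) = v}, (Polynomial.X ^ w.asIdeal.inertiaDeg (NumberField.RingOfIntegers F) - Polynomial.C (ι.symm (θ.valueAtUniformizer w)⁻¹)))) → ∃ π : Literature.NumberTheory.Automorphic.CuspidalAutomorphicRepData 2 F hcpt, π.1.IsLAlgebraic ∧ ∀ᶠ v in Filter.cofinite, Summit.Langlands.SatakeFrobCompatibleAt ι π.1 ρ v)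
    (h3 : ∀ (F : Type) [Field F] [NumberField F], NumberField.IsTotallyComplex F → Module.finrank ℚ F = 2 → ∀ (p : ℕ) [Fact p.Prime], p ≠ 2 → ∀ (hcpt : Literature.NumberTheory.Automorphic.isCompact_glFiniteIntegralLevel 2 F) (ι : PadicAlgCl p ≃+* ℂ) (ρ : Literature.NumberTheory.GaloisRepresentations.FramedGaloisRep F (PadicAlgCl p) 2), ρ.toGaloisRep.IsIrreducible → (∃ 𝒰 : Literature.NumberTheory.Automorphic.BigHeckeGLn.TameLevel 2 F p, 𝒰.IsMaximalAbove ∧ ∃ x : Literature.NumberTheory.Automorphic.OrdinaryHeckeAlgebraGLn 𝒰 →+* PadicAlgCl p, Continuous x ∧ 𝒰.IsOrdAssociated x ρ ∧ ∃ N : ℕ, 0 < N ∧ ∀ (u : NumberField.RingOfIntegers F) (û : ∀ v : IsDedekindDomain.HeightOneSpectrum (NumberField.RingOfIntegers F), (p : NumberField.RingOfIntegers F) ∈ v.asIdeal → (v.adicCompletionIntegers F)ˣ), (∀ (v : IsDedekindDomain.HeightOneSpectrum (NumberField.RingOfIntegers F)) (hv : (p : NumberField.RingOfIntegers F) ∈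 v.asIdeal), ((û v hv : v.adicCompletionIntegers F) : v.adicCompletion F) = algebraMap F (v.adicCompletion F) (u : F)) → (∏ᶠ v : {v : IsDedekindDomain.HeightOneSpectrum (NumberField.RingOfIntegers F) // (p : NumberField.RingOfIntegers F) ∈ v.asIdeal}, x (𝒰.ordDiamond v.2 (Pi.mulSingle (0 : Fin 2) (û v.1 v.2)))) ^ N = 1) → (∃ k : ℕ, 2 ≤ k ∧ ∃ m : ℕ, 0 < m ∧ ∀ v : IsDedekindDomain.HeightOneSpectrum (NumberField.RingOfIntegers F), (p : NumberField.RingOfIntegers F) ∈ v.asIdeal → ρ.IsOrdinaryOfWeightAt p v k m) → ∃ π : Literature.NumberTheory.Automorphic.CuspidalAutomorphicRepData 2 F hcpt, π.1.IsLAlgebraic ∧ ∀ᶠ v in Filter.cofinite, Summit.Langlands.SatakeFrobCompatibleAt ι π.1 ρ v)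
    (h4 : ∀ (F : Type) [Field F] [NumberField F] (p : ℕ) [Fact p.Prime] (𝒰 : Literature.NumberTheory.Automorphic.BigHeckeGLn.TameLevel 2 F p), 𝒰.IsMaximalAbove → (∀ ι : Literature.NumberTheory.Automorphic.TowerIndex, Finite (𝒰.hidaCohomology ℤ ι)) → ∀ (y : Literature.NumberTheory.Automorphic.HidaHeckeAlgebraGLn 𝒰 →+* PadicAlgCl p), Continuous y → (∀ v : IsDedekindDomain.HeightOneSpectrum (NumberField.RingOfIntegers F), (p : NumberField.RingOfIntegers F) ∈ v.asIdeal → 𝒰.IsSlopeZeroAt y v) → ∃ x : Literature.NumberTheory.Automorphic.OrdinaryHeckeAlgebraGLn 𝒰 →+* PadicAlgCl p, Continuous x ∧ x.comp (𝒰.toOrd ℤ) = y)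
    (h5 : ∀ (K : Type) [Field K] [NumberField K], Module.finrank ℚ K = 2 → NumberField.IsTotallyComplex K → ∀ (p : ℕ) [Fact p.Prime] (𝒰 : Literature.NumberTheory.Automorphic.BigHeckeGLn.TameLevel 2 K p) (x : Literature.NumberTheory.Automorphic.TowerIndex), Finite (𝒰.hidaCohomology ℤ x)) :
    RamifiedPrimeExit :=
  fun F _ _ hF hdeg p _ hp hs hr => seam_at h4 h5 F hF hdeg p hp (h1 F hF hdeg p hp hs hr) (h2 F p) (h3 F hF hdeg p hp)

/-- The skeleton concludes the cell BY NAME from the registered stubs. -/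
theorem RamifiedPrimeExit_of_stubs : RamifiedPrimeExit := RamifiedPrimeExit_of stub_ramifiedOrdinaryFactorisationNonCM stub_cmInducedClassical stub_ordinarilyProModularOrdinaryClassical stub_slopeZeroFactorisationKT stub_hidaTowerCohomologyFiniteQuadratic


/-- identity with the born route decl (elaborates only AFTER birth). -/
theorem RamifiedPrimeExit_iff_route : RamifiedPrimeExit ↔ Summit.Langlands.Langlands.Theses.SplitPrimeExitCarving.RamifiedPrimeExit := Iff.rfl

/-- the ROUTE decl from the stubs. -/
theorem route_RamifiedPrimeExit_of_stubs : Summit.Langlands.Langlands.Theses.SplitPrimeExitCarving.RamifiedPrimeExit := RamifiedPrimeExit_iff_route.1 RamifiedPrimeExit_of_stubs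

end Summit.Langlands.Langlands.Theses.SplitPrimeExitCarving.Birth.RamifiedPrimeExit
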